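import Summits.HubbardSuperconductivity.HubbardSuperconductivity.Theorems.LevyLogBootstrapDressHalfFilledPairResolventSylvester
import HarnessLib

/-!
# Crux `DressHalfFilled` (stmt-HubbardSuperconductivity-8148, route `LevyLogBootstrap`; shared with route
# `AnisotropyChord`): the a-posteriori certificate for Kato's two-body resolvent kernel `pairResolvent`

Support file (`--supports stmt-HubbardSuperconductivity-8148`) for STUB 1 `stub_plaquetteData` (clause (W1), the
Kato-kernel window), continuing `…DressHalfFilledPairResolventSylvester` (the block-projected spectral sum `X` with
`pairResolvent hH E a b c d = Σ_{ij} ā_i c̄_j X_{ij}` and `H X + X Hᵀ - E X = b dᵀ`). Here, for a Hermitian `H`, two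
coordinate blocks `p₁, p₂` with form floors `θ₁, θ₂` and an energy `E < θ₁ + θ₂`:

* `sylvester_coercive` — `(θ₁+θ₂-E) ‖Z‖_F² ≤ Re⟨Z, H Z + Z Hᵀ - E Z⟩_F` on matrices supported on `p₁ × p₂`
  (columns see `θ₁`, rows see `θ₂`); `sylvester_eucNorm_le` — hence `(θ₁+θ₂-E) ‖Z‖_F ≤ ‖H Z + Z Hᵀ - E Z‖_F`;
* `pairResolvent_certificate` — for ANY trial matrix `Y` supported on `p₁ × p₂` and `a, b` on `p₁`, `c, d` on `p₂`,
  `(θ₁+θ₂-E) · |pairResolvent hH E a b c d - Σ_{ij} ā_i c̄_j Y_{ij}| ≤ ‖a‖ ‖c‖ ‖b dᵀ - (H Y + Y Hᵀ - E Y)‖_F` — the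
  kernel only has to evaluate the residual of `Y`; `norm_pairResolvent_le` (`Y = 0`):
  `(θ₁+θ₂-E) |pairResolvent hH E a b c d| ≤ ‖a‖ ‖b‖ ‖c‖ ‖d‖`.

Sources: T. Kato, *Perturbation Theory for Linear Operators* (1966) I-§5.3; W.-F. Tsai, S. A. Kivelson, PRB 73 (2006)
214510, App. A; elementary residual (Lax–Milgram) linear algebra. No definition and no named fact is introduced.
-/

noncomputable section

set_option linter.dupNamespace false

namespace Summit.HubbardSuperconductivity.HubbardSuperconductivity.Theorems.LevyLogBootstrap

open Matrix Finset Literature.MathematicalPhysics.QuantumLattice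
open scoped ComplexOrder

section Generic

variable {m : Type*} [Fintype m] [DecidableEq m]

section Sylvester

/-! ### Coercivity of the Sylvester operator on the product block -/

omit [DecidableEq m] in
/-- **Coercivity**: on matrices `Z` supported on `p₁ × p₂`,
`(θ₁ + θ₂ - E) Σ ‖Z_{ij}‖² ≤ Re Σ_{ij} Z̄_{ij} (H Z + Z Hᵀ - E Z)_{ij}` — the columns of `Z` are vectors
supported on `p₁` (floor `θ₁`), its rows vectors supported on `p₂` (floor `θ₂`). [folklore] -/
theorem sylvester_coercive {H : Matrix m m ℂ} (p₁ p₂ : m → Prop) {θ₁ θ₂ : ℝ}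
    (hθ₁ : ∀ u : m → ℂ, (∀ j, ¬ p₁ j → u j = 0) → θ₁ * (star u ⬝ᵥ u).re ≤ (star u ⬝ᵥ H *ᵥ u).re)
    (hθ₂ : ∀ u : m → ℂ, (∀ j, ¬ p₂ j → u j = 0) → θ₂ * (star u ⬝ᵥ u).re ≤ (star u ⬝ᵥ H *ᵥ u).re)
    (E : ℝ) {Z : Matrix m m ℂ} (hZ : ∀ i j, ¬ (p₁ i ∧ p₂ j) → Z i j = 0) :
    (θ₁ + θ₂ - E) * ∑ i, ∑ j, ‖Z i j‖ ^ 2 ≤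
      (∑ i, ∑ j, star (Z i j) * (H * Z + Z * Hᵀ - (E : ℂ) • Z) i j).re := by
  -- columns
  have hcol : ∀ j, θ₁ * ∑ i, ‖Z i j‖ ^ 2 ≤ (∑ i, star (Z i j) * (H * Z) i j).re := by
    intro j
    have hsupp : ∀ i, ¬ p₁ i → (fun i => Z i j) i = 0 := fun i hi => hZ i j (fun h => hi h.1)
    have h := hθ₁ (fun i => Z i j) hsupp
    rw [star_dotProduct_self_re_eq_sum] at h
    convert h using 2
    simp only [dotProduct, Pi.star_apply, mulVec, Matrix.mul_apply]
  -- rows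
  have hrow : ∀ i, θ₂ * ∑ j, ‖Z i j‖ ^ 2 ≤ (∑ j, star (Z i j) * (Z * Hᵀ) i j).re := by
    intro i
    have hsupp : ∀ j, ¬ p₂ j → (fun j => Z i j) j = 0 := fun j hj => hZ i j (fun h => hj h.2)
    have h := hθ₂ (fun j => Z i j) hsupp
    rw [star_dotProduct_self_re_eq_sum] at h
    convert h using 2
    simp only [dotProduct, Pi.star_apply, mulVec, Matrix.mul_apply, transpose_apply]
    refine Finset.sum_congr rfl fun j _ => ?_
    congr 1
    exact Finset.sum_congr rfl fun k _ => mul_comm _ _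
  -- the `E` part
  have hE : ∀ i j, (star (Z i j) * (((E : ℂ) • Z) i j)).re = E * ‖Z i j‖ ^ 2 := by
    intro i j
    rw [Matrix.smul_apply, smul_eq_mul, Complex.star_def, show (starRingEnd ℂ) (Z i j) * ((E : ℂ) * Z i j) =
      (E : ℂ) * ((starRingEnd ℂ) (Z i j) * Z i j) by ring, Complex.conj_mul', ← Complex.ofReal_pow,
      ← Complex.ofReal_mul, Complex.ofReal_re]
  -- assemble
  have hsplit : (∑ i, ∑ j, star (Z i j) * (H * Z + Z * Hᵀ - (E : ℂ) • Z) i j).re =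
      (∑ j, (∑ i, star (Z i j) * (H * Z) i j).re) + (∑ i, (∑ j, star (Z i j) * (Z * Hᵀ) i j).re) -
        E * ∑ i, ∑ j, ‖Z i j‖ ^ 2 := by
    simp only [Matrix.sub_apply, Matrix.add_apply, mul_sub, mul_add, Finset.sum_sub_distrib,
      Finset.sum_add_distrib, Complex.sub_re, Complex.add_re, Complex.re_sum, hE, Finset.mul_sum]
    rw [Finset.sum_comm]
  rw [hsplit]
  have h1 : θ₁ * ∑ i, ∑ j, ‖Z i j‖ ^ 2 ≤ ∑ j, (∑ i, star (Z i j) * (H * Z) i j).re := by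
    rw [Finset.sum_comm, Finset.mul_sum]
    exact Finset.sum_le_sum fun j _ => hcol j
  have h2 : θ₂ * ∑ i, ∑ j, ‖Z i j‖ ^ 2 ≤ ∑ i, (∑ j, star (Z i j) * (Z * Hᵀ) i j).re := by
    rw [Finset.mul_sum]
    exact Finset.sum_le_sum fun i _ => hrow i
  nlinarith

omit [DecidableEq m] in
/-- **Coercivity in norm form**: on matrices supported on `p₁ × p₂`,
`(θ₁ + θ₂ - E) ‖Z‖_F ≤ ‖H Z + Z Hᵀ - E Z‖_F` (Cauchy–Schwarz; `E < θ₁ + θ₂`). [folklore] -/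
theorem sylvester_eucNorm_le {H : Matrix m m ℂ} (p₁ p₂ : m → Prop) {θ₁ θ₂ : ℝ}
    (hθ₁ : ∀ u : m → ℂ, (∀ j, ¬ p₁ j → u j = 0) → θ₁ * (star u ⬝ᵥ u).re ≤ (star u ⬝ᵥ H *ᵥ u).re)
    (hθ₂ : ∀ u : m → ℂ, (∀ j, ¬ p₂ j → u j = 0) → θ₂ * (star u ⬝ᵥ u).re ≤ (star u ⬝ᵥ H *ᵥ u).re)
    {E : ℝ} (hE : E < θ₁ + θ₂) {Z : Matrix m m ℂ} (hZ : ∀ i j, ¬ (p₁ i ∧ p₂ j) → Z i j = 0) :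
    (θ₁ + θ₂ - E) * eucNorm (fun ij : m × m => Z ij.1 ij.2) ≤
      eucNorm (fun ij : m × m => (H * Z + Z * Hᵀ - (E : ℂ) • Z) ij.1 ij.2) := by
  set z : m × m → ℂ := fun ij => Z ij.1 ij.2 with hz
  set w : m × m → ℂ := fun ij => (H * Z + Z * Hᵀ - (E : ℂ) • Z) ij.1 ij.2 with hw
  have hg : 0 < θ₁ + θ₂ - E := by linarith
  have hco := sylvester_coercive p₁ p₂ hθ₁ hθ₂ E hZ
  have hF : ∑ i, ∑ j, ‖Z i j‖ ^ 2 = eucNorm z ^ 2 := by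
    rw [eucNorm_sq, star_dotProduct_self_re_eq_sum, Fintype.sum_prod_type]
  have hP : ∑ i, ∑ j, star (Z i j) * (H * Z + Z * Hᵀ - (E : ℂ) • Z) i j = star z ⬝ᵥ w := by
    rw [dotProduct, Fintype.sum_prod_type]
    rfl
  rw [hF, hP] at hco
  have hcs : (star z ⬝ᵥ w).re ≤ eucNorm z * eucNorm w :=
    (Complex.re_le_norm _).trans (norm_star_dotProduct_le z w)
  have hzn := eucNorm_nonneg z
  by_cases h0 : eucNorm z = 0
  · rw [h0, mul_zero]; exact eucNorm_nonneg _
  · have hzpos : 0 < eucNorm z := lt_of_le_of_ne hzn (Ne.symm h0)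
    have : (θ₁ + θ₂ - E) * eucNorm z * eucNorm z ≤ eucNorm w * eucNorm z := by nlinarith
    exact le_of_mul_le_mul_right this hzpos

/-! ### The certificate -/

/-- **The a-posteriori certificate for `pairResolvent`, general form.** Blocks `p₁, p₂` of `H` with form floors
`θ₁, θ₂`, `E < θ₁ + θ₂`; `a` supported on `p₁`, `c` supported on `p₂`, `b, d` ARBITRARY. For any trial matrix `Y`
supported on `p₁ × p₂`,
`(θ₁+θ₂-E) · |pairResolvent hH E a b c d - Σ_{ij} ā_i c̄_j Y_{ij}| ≤ ‖a‖ ‖c‖ ‖(𝟙_{p₁}b)(𝟙_{p₂}d)ᵀ - (H Y + Y Hᵀ - E Y)‖_F`.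
[folklore] -/
theorem pairResolvent_certificate_trunc {H : Matrix m m ℂ} (hH : H.IsHermitian) (p₁ p₂ : m → Prop) [DecidablePred p₁]
    [DecidablePred p₂] (hK₁ : ∀ j k, ¬ p₁ j → p₁ k → H j k = 0)
    (hK₂ : ∀ j k, ¬ p₂ j → p₂ k → H j k = 0) {θ₁ θ₂ E : ℝ}
    (hθ₁ : ∀ u : m → ℂ, (∀ j, ¬ p₁ j → u j = 0) → θ₁ * (star u ⬝ᵥ u).re ≤ (star u ⬝ᵥ H *ᵥ u).re)
    (hθ₂ : ∀ u : m → ℂ, (∀ j, ¬ p₂ j → u j = 0) → θ₂ * (star u ⬝ᵥ u).re ≤ (star u ⬝ᵥ H *ᵥ u).re)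
    (hE : E < θ₁ + θ₂) {a c : m → ℂ} (ha : ∀ j, ¬ p₁ j → a j = 0) (hc : ∀ j, ¬ p₂ j → c j = 0) (b d : m → ℂ)
    {Y : Matrix m m ℂ} (hY : ∀ i j, ¬ (p₁ i ∧ p₂ j) → Y i j = 0) :
    (θ₁ + θ₂ - E) * ‖pairResolvent hH E a b c d - ∑ i, ∑ j, star (a i) * star (c j) * Y i j‖ ≤
      eucNorm a * eucNorm c *
        eucNorm (fun ij : m × m => (vecMulVec (fun j => if p₁ j then b j else 0) (fun j => if p₂ j then d j else 0) -
          (H * Y + Y * Hᵀ - (E : ℂ) • Y)) ij.1 ij.2) := by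
  -- the exact solution
  set X : Matrix m m ℂ := ∑ μ, ∑ ν, ((((hH.eigenvalues μ + hH.eigenvalues ν - E : ℝ) : ℂ))⁻¹ *
      (star ⇑(hH.eigenvectorBasis μ) ⬝ᵥ b) * (star ⇑(hH.eigenvectorBasis ν) ⬝ᵥ d)) •
    vecMulVec (fun j => if p₁ j then (⇑(hH.eigenvectorBasis μ) : m → ℂ) j else 0)
      (fun j => if p₂ j then (⇑(hH.eigenvectorBasis ν) : m → ℂ) j else 0) with hXdef
  have hPR : pairResolvent hH E a b c d = ∑ i, ∑ j, star (a i) * star (c j) * X i j :=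
    pairResolvent_eq_pairing_solution hH p₁ p₂ E ha b hc d X hXdef
  have hSyl : H * X + X * Hᵀ - (E : ℂ) • X =
      vecMulVec (fun j => if p₁ j then b j else 0) (fun j => if p₂ j then d j else 0) :=
    sylvester_pairingSolution hH p₁ p₂ hK₁ hK₂ hθ₁ hθ₂ hE b d X hXdef
  have hXsupp : ∀ i j, ¬ (p₁ i ∧ p₂ j) → X i j = 0 := by
    intro i j hij
    simp only [hXdef, Matrix.sum_apply, Matrix.smul_apply, vecMulVec_apply, smul_eq_mul]
    refine Finset.sum_eq_zero fun μ _ => Finset.sum_eq_zero fun ν _ => ?_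
    by_cases hi : p₁ i
    · have hj : ¬ p₂ j := fun hj => hij ⟨hi, hj⟩
      rw [if_neg hj, mul_zero, mul_zero]
    · rw [if_neg hi, zero_mul, mul_zero]
  set D : Matrix m m ℂ := X - Y with hD
  have hDsupp : ∀ i j, ¬ (p₁ i ∧ p₂ j) → D i j = 0 := fun i j hij => by
    rw [hD, Matrix.sub_apply, hXsupp i j hij, hY i j hij, sub_zero]
  have hDimg : H * D + D * Hᵀ - (E : ℂ) • D =
      vecMulVec (fun j => if p₁ j then b j else 0) (fun j => if p₂ j then d j else 0) -
        (H * Y + Y * Hᵀ - (E : ℂ) • Y) := by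
    rw [hD, ← hSyl, Matrix.mul_sub, Matrix.sub_mul, smul_sub]
    abel
  have hdiff : pairResolvent hH E a b c d - ∑ i, ∑ j, star (a i) * star (c j) * Y i j =
      star (fun ij : m × m => a ij.1 * c ij.2) ⬝ᵥ (fun ij : m × m => D ij.1 ij.2) := by
    rw [hPR, ← pairing_eq_dotProduct, ← Finset.sum_sub_distrib]
    refine Finset.sum_congr rfl fun i _ => ?_
    rw [← Finset.sum_sub_distrib]
    refine Finset.sum_congr rfl fun j _ => ?_
    rw [hD, Matrix.sub_apply, mul_sub]
  rw [hdiff]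
  have hcs := norm_star_dotProduct_le (fun ij : m × m => a ij.1 * c ij.2) (fun ij : m × m => D ij.1 ij.2)
  rw [eucNorm_tensor] at hcs
  have hco := sylvester_eucNorm_le p₁ p₂ hθ₁ hθ₂ hE hDsupp
  rw [hDimg] at hco
  have hg : 0 < θ₁ + θ₂ - E := by linarith
  calc (θ₁ + θ₂ - E) * ‖star (fun ij : m × m => a ij.1 * c ij.2) ⬝ᵥ fun ij => D ij.1 ij.2‖
      ≤ (θ₁ + θ₂ - E) * (eucNorm a * eucNorm c * eucNorm (fun ij : m × m => D ij.1 ij.2)) :=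
        mul_le_mul_of_nonneg_left hcs hg.le
    _ = eucNorm a * eucNorm c * ((θ₁ + θ₂ - E) * eucNorm (fun ij : m × m => D ij.1 ij.2)) := by ring
    _ ≤ _ := mul_le_mul_of_nonneg_left hco (mul_nonneg (eucNorm_nonneg _) (eucNorm_nonneg _))

/-- **Orthogonal sectors give zero.** If `a` is supported on `p₁` but `b` vanishes ON `p₁` (or `c` on `p₂` but `d` vanishes on
`p₂`), then `pairResolvent hH E a b c d = 0` (the certificate with `Y = 0` has zero residual). [folklore] -/
theorem pairResolvent_eq_zero_of_orthogonal_blocks {H : Matrix m m ℂ} (hH : H.IsHermitian) (p₁ p₂ : m → Prop) [DecidablePred p₁]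
    [DecidablePred p₂] (hK₁ : ∀ j k, ¬ p₁ j → p₁ k → H j k = 0)
    (hK₂ : ∀ j k, ¬ p₂ j → p₂ k → H j k = 0) {θ₁ θ₂ E : ℝ}
    (hθ₁ : ∀ u : m → ℂ, (∀ j, ¬ p₁ j → u j = 0) → θ₁ * (star u ⬝ᵥ u).re ≤ (star u ⬝ᵥ H *ᵥ u).re)
    (hθ₂ : ∀ u : m → ℂ, (∀ j, ¬ p₂ j → u j = 0) → θ₂ * (star u ⬝ᵥ u).re ≤ (star u ⬝ᵥ H *ᵥ u).re)
    (hE : E < θ₁ + θ₂) {a c : m → ℂ} (ha : ∀ j, ¬ p₁ j → a j = 0) (hc : ∀ j, ¬ p₂ j → c j = 0) {b d : m → ℂ}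
    (h0 : (∀ j, p₁ j → b j = 0) ∨ (∀ j, p₂ j → d j = 0)) :
    pairResolvent hH E a b c d = 0 := by
  have h := pairResolvent_certificate_trunc hH p₁ p₂ hK₁ hK₂ hθ₁ hθ₂ hE ha hc b d (Y := 0) (fun _ _ _ => rfl)
  have hvec : vecMulVec (fun j => if p₁ j then b j else 0) (fun j => if p₂ j then d j else 0) = 0 := by
    ext i j
    rw [vecMulVec_apply, Matrix.zero_apply]
    rcases h0 with hb | hd
    · by_cases hi : p₁ i
      · rw [if_pos hi, hb i hi, zero_mul]
      · rw [if_neg hi, zero_mul]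
    · by_cases hj : p₂ j
      · rw [if_pos hj, hd j hj, mul_zero]
      · rw [if_neg hj, mul_zero]
  simp only [Matrix.zero_apply, mul_zero, Finset.sum_const_zero, sub_zero, Matrix.zero_mul, add_zero,
    smul_zero, hvec] at h
  have hz : eucNorm (fun _ : m × m => (0 : ℂ)) = 0 := by
    rw [show (fun _ : m × m => (0 : ℂ)) = 0 from rfl, eucNorm, WithLp.toLp_zero, norm_zero]
  rw [hz, mul_zero] at h
  have hg : 0 < θ₁ + θ₂ - E := by linarith
  have : ‖pairResolvent hH E a b c d‖ ≤ 0 := by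
    have := h; nlinarith [norm_nonneg (pairResolvent hH E a b c d)]
  exact norm_le_zero_iff.1 this

/-- **The a-posteriori certificate for `pairResolvent`.** Blocks `p₁, p₂` of `H` with form floors `θ₁, θ₂`,
`E < θ₁ + θ₂`; `a, b` supported on `p₁`, `c, d` supported on `p₂`. For ANY trial matrix `Y` supported on
`p₁ × p₂`, `(θ₁+θ₂-E) · |pairResolvent hH E a b c d - Σ_{ij} ā_i c̄_j Y_{ij}| ≤ ‖a‖ ‖c‖ ‖b dᵀ - (H Y + Y Hᵀ - E Y)‖_F`
— only the residual of `Y` has to be evaluated. [folklore] -/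
theorem pairResolvent_certificate {H : Matrix m m ℂ} (hH : H.IsHermitian) (p₁ p₂ : m → Prop) [DecidablePred p₁]
    [DecidablePred p₂] (hK₁ : ∀ j k, ¬ p₁ j → p₁ k → H j k = 0)
    (hK₂ : ∀ j k, ¬ p₂ j → p₂ k → H j k = 0) {θ₁ θ₂ E : ℝ}
    (hθ₁ : ∀ u : m → ℂ, (∀ j, ¬ p₁ j → u j = 0) → θ₁ * (star u ⬝ᵥ u).re ≤ (star u ⬝ᵥ H *ᵥ u).re)
    (hθ₂ : ∀ u : m → ℂ, (∀ j, ¬ p₂ j → u j = 0) → θ₂ * (star u ⬝ᵥ u).re ≤ (star u ⬝ᵥ H *ᵥ u).re)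
    (hE : E < θ₁ + θ₂) {a b c d : m → ℂ} (ha : ∀ j, ¬ p₁ j → a j = 0) (hb : ∀ j, ¬ p₁ j → b j = 0)
    (hc : ∀ j, ¬ p₂ j → c j = 0) (hd : ∀ j, ¬ p₂ j → d j = 0)
    {Y : Matrix m m ℂ} (hY : ∀ i j, ¬ (p₁ i ∧ p₂ j) → Y i j = 0) :
    (θ₁ + θ₂ - E) * ‖pairResolvent hH E a b c d - ∑ i, ∑ j, star (a i) * star (c j) * Y i j‖ ≤
      eucNorm a * eucNorm c *
        eucNorm (fun ij : m × m => (vecMulVec b d - (H * Y + Y * Hᵀ - (E : ℂ) • Y)) ij.1 ij.2) := by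
  -- the exact solution
  set X : Matrix m m ℂ := ∑ μ, ∑ ν, ((((hH.eigenvalues μ + hH.eigenvalues ν - E : ℝ) : ℂ))⁻¹ *
      (star ⇑(hH.eigenvectorBasis μ) ⬝ᵥ b) * (star ⇑(hH.eigenvectorBasis ν) ⬝ᵥ d)) •
    vecMulVec (fun j => if p₁ j then (⇑(hH.eigenvectorBasis μ) : m → ℂ) j else 0)
      (fun j => if p₂ j then (⇑(hH.eigenvectorBasis ν) : m → ℂ) j else 0) with hXdef
  have hPR : pairResolvent hH E a b c d = ∑ i, ∑ j, star (a i) * star (c j) * X i j :=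
    pairResolvent_eq_pairing_solution hH p₁ p₂ E ha b hc d X hXdef
  have hSyl : H * X + X * Hᵀ - (E : ℂ) • X = vecMulVec b d := by
    have h := sylvester_pairingSolution hH p₁ p₂ hK₁ hK₂ hθ₁ hθ₂ hE b d X hXdef
    rwa [indicator_eq_self_of_support p₁ hb, indicator_eq_self_of_support p₂ hd] at h
  have hXsupp : ∀ i j, ¬ (p₁ i ∧ p₂ j) → X i j = 0 := by
    intro i j hij
    simp only [hXdef, Matrix.sum_apply, Matrix.smul_apply, vecMulVec_apply, smul_eq_mul]
    refine Finset.sum_eq_zero fun μ _ => Finset.sum_eq_zero fun ν _ => ?_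
    by_cases hi : p₁ i
    · have hj : ¬ p₂ j := fun hj => hij ⟨hi, hj⟩
      rw [if_neg hj, mul_zero, mul_zero]
    · rw [if_neg hi, zero_mul, mul_zero]
  -- the difference `D = X - Y` is supported and its Sylvester image is the residual of `Y`
  set D : Matrix m m ℂ := X - Y with hD
  have hDsupp : ∀ i j, ¬ (p₁ i ∧ p₂ j) → D i j = 0 := fun i j hij => by
    rw [hD, Matrix.sub_apply, hXsupp i j hij, hY i j hij, sub_zero]
  have hDimg : H * D + D * Hᵀ - (E : ℂ) • D = vecMulVec b d - (H * Y + Y * Hᵀ - (E : ℂ) • Y) := by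
    rw [hD, ← hSyl, Matrix.mul_sub, Matrix.sub_mul, smul_sub]
    abel
  -- pairing difference = ⟨a ⊗ c, D⟩
  have hdiff : pairResolvent hH E a b c d - ∑ i, ∑ j, star (a i) * star (c j) * Y i j =
      star (fun ij : m × m => a ij.1 * c ij.2) ⬝ᵥ (fun ij : m × m => D ij.1 ij.2) := by
    rw [hPR, ← pairing_eq_dotProduct, ← Finset.sum_sub_distrib]
    refine Finset.sum_congr rfl fun i _ => ?_
    rw [← Finset.sum_sub_distrib]
    refine Finset.sum_congr rfl fun j _ => ?_
    rw [hD, Matrix.sub_apply, mul_sub]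
  rw [hdiff]
  have hcs := norm_star_dotProduct_le (fun ij : m × m => a ij.1 * c ij.2) (fun ij : m × m => D ij.1 ij.2)
  rw [eucNorm_tensor] at hcs
  have hco := sylvester_eucNorm_le p₁ p₂ hθ₁ hθ₂ hE hDsupp
  rw [hDimg] at hco
  have hg : 0 < θ₁ + θ₂ - E := by linarith
  calc (θ₁ + θ₂ - E) * ‖star (fun ij : m × m => a ij.1 * c ij.2) ⬝ᵥ fun ij => D ij.1 ij.2‖
      ≤ (θ₁ + θ₂ - E) * (eucNorm a * eucNorm c * eucNorm (fun ij : m × m => D ij.1 ij.2)) :=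
        mul_le_mul_of_nonneg_left hcs hg.le
    _ = eucNorm a * eucNorm c * ((θ₁ + θ₂ - E) * eucNorm (fun ij : m × m => D ij.1 ij.2)) := by ring
    _ ≤ _ := mul_le_mul_of_nonneg_left hco (mul_nonneg (eucNorm_nonneg _) (eucNorm_nonneg _))

/-- **Boundedness of the pair resolvent** (the certificate with `Y = 0`):
`(θ₁+θ₂-E) |pairResolvent hH E a b c d| ≤ ‖a‖ ‖b‖ ‖c‖ ‖d‖`. [folklore] -/
theorem norm_pairResolvent_le {H : Matrix m m ℂ} (hH : H.IsHermitian) (p₁ p₂ : m → Prop) [DecidablePred p₁]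
    [DecidablePred p₂] (hK₁ : ∀ j k, ¬ p₁ j → p₁ k → H j k = 0)
    (hK₂ : ∀ j k, ¬ p₂ j → p₂ k → H j k = 0) {θ₁ θ₂ E : ℝ}
    (hθ₁ : ∀ u : m → ℂ, (∀ j, ¬ p₁ j → u j = 0) → θ₁ * (star u ⬝ᵥ u).re ≤ (star u ⬝ᵥ H *ᵥ u).re)
    (hθ₂ : ∀ u : m → ℂ, (∀ j, ¬ p₂ j → u j = 0) → θ₂ * (star u ⬝ᵥ u).re ≤ (star u ⬝ᵥ H *ᵥ u).re)
    (hE : E < θ₁ + θ₂) {a b c d : m → ℂ} (ha : ∀ j, ¬ p₁ j → a j = 0) (hb : ∀ j, ¬ p₁ j → b j = 0)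
    (hc : ∀ j, ¬ p₂ j → c j = 0) (hd : ∀ j, ¬ p₂ j → d j = 0) :
    (θ₁ + θ₂ - E) * ‖pairResolvent hH E a b c d‖ ≤ eucNorm a * eucNorm b * eucNorm c * eucNorm d := by
  have h := pairResolvent_certificate hH p₁ p₂ hK₁ hK₂ hθ₁ hθ₂ hE ha hb hc hd
    (Y := 0) (fun _ _ _ => rfl)
  simp only [Matrix.zero_apply, mul_zero, Finset.sum_const_zero, sub_zero,
    Matrix.zero_mul, add_zero, smul_zero] at h
  rw [eucNorm_vecMulVec] at h
  calc (θ₁ + θ₂ - E) * ‖pairResolvent hH E a b c d‖ ≤ eucNorm a * eucNorm c * (eucNorm b * eucNorm d) := h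
    _ = eucNorm a * eucNorm b * eucNorm c * eucNorm d := by ring

end Sylvester

end Generic

/-! ### Registered sub-goal of the crux item (stmt-HubbardSuperconductivity-8148) -/

set_option linter.style.longLine false in
/-- Registered sub-goal `dressHalfFilled_pairResolventCertificate` of the crux item (closed, `Type`-level restatement of
`pairResolvent_certificate`): the a-posteriori residual bound for `pairResolvent`. [folklore] -/
theorem dressHalfFilled_pairResolventCertificate : ∀ {m : Type} [Fintype m] [DecidableEq m] {H : Matrix m m ℂ} (hH : H.IsHermitian) (p₁ p₂ : m → Prop) [DecidablePred p₁] [DecidablePred p₂], (∀ j k, ¬ p₁ j → p₁ k → H j k = 0) → (∀ j k, ¬ p₂ j → p₂ k → H j k = 0) → ∀ {θ₁ θ₂ E : ℝ}, (∀ u : m → ℂ, (∀ j, ¬ p₁ j → u j = 0) → θ₁ * (star u ⬝ᵥ u).re ≤ (star u ⬝ᵥ Matrix.mulVec H u).re) → (∀ u : m → ℂ, (∀ j, ¬ p₂ j → u j = 0) → θ₂ * (star u ⬝ᵥ u).re ≤ (star u ⬝ᵥ Matrix.mulVec H u).re) → E < θ₁ + θ₂ → ∀ {a b c d : m → ℂ},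 (∀ j, ¬ p₁ j → a j = 0) → (∀ j, ¬ p₁ j → b j = 0) → (∀ j, ¬ p₂ j → c j = 0) → (∀ j, ¬ p₂ j → d j = 0) → ∀ {Y : Matrix m m ℂ}, (∀ i j, ¬ (p₁ i ∧ p₂ j) → Y i j = 0) → (θ₁ + θ₂ - E) * ‖Literature.MathematicalPhysics.QuantumLattice.pairResolvent hH E a b c d - ∑ i, ∑ j, star (a i) * star (c j) * Y i j‖ ≤ Literature.MathematicalPhysics.QuantumLattice.eucNorm a * Literature.MathematicalPhysics.QuantumLattice.eucNorm c * Literature.MathematicalPhysics.QuantumLattice.eucNorm (fun ij : m × m => (Matrix.vecMulVec b d - (H * Y + Y * Matrix.transpose H - (E : ℂ) • Y)) ij.1 ij.2) :=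
  by
  intro m _ _ H hH p₁ p₂ _ _ hK₁ hK₂ θ₁ θ₂ E hθ₁ hθ₂ hE a b c d ha hb hc hd Y hY
  exact pairResolvent_certificate hH p₁ p₂ hK₁ hK₂ hθ₁ hθ₂ hE ha hb hc hd hY

end Summit.HubbardSuperconductivity.HubbardSuperconductivity.Theorems.LevyLogBootstrap

end
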